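import Summits.Schanuel.Schanuel.Theorems.ZilberEacParamFibreCurveComplete
import Summits.Schanuel.Schanuel.Theorems.ZilberEacGraphSurfaceDictionary
import Summits.Schanuel.Schanuel.Theorems.ZilberEacParamCurveExamples
import HarnessLib

/-!
# Polynomially parametrised base curves, XXIV: the DICTIONARY LEMMA — a surface of
# Mantova–Masser's case whose base curve is `g(ℂ)` IS an `S(g; Q)`; LITERAL capstones for abstract `W`

HONEST FRAMING.  Cell `pub-schanuel` (Zilber's Exponential-Algebraic Closedness, case ladder;
host summit Schanuel), seat 2, gen 20 (HANDOFF O72 (b)).  The theorems of gens 19–20 take the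
surface in the explicit form `S(g; Q) = {(g₀(t), g₁(t), y₀, y₁) : Q(t; y₀, y₁) = 0}` with the datum
"`Q(t; ·)` vanishes on `(ℂˣ)²` for infinitely many `t`".  This file proves that EVERY `W ⊆ ℂ² × ℂ²`
in Mantova–Masser's case (dim-π-S-1-free) whose base curve `cl π(W ∩ G²)` is the polynomially
parametrised curve `C = {(g₀(t), g₁(t))}` (`deg g₀ ≥ 1`) is of this form
(`exists_eq_paramSurface₃_of_mmCase`), by the argument of gen 18's graph dictionary
(`ZilberEacGraphSurfaceDictionary`) with LYING-OVER replacing surjectivity: the substitution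
`θ : x ↦ g(t), y ↦ y` makes `ℂ[t, y]` integral over `ℂ[x, y]` (`isIntegral_paramSubst₃`), its
kernel vanishes on `W` (every point of `W` lies over `C`), so the prime `I(W)` lifts to a prime
`J ⊆ ℂ[t, y₀, y₁]` with `θ⁻¹(J) = I(W)` and `dim ℂ[t, y]/J = dim ℂ[x, y]/I(W) = 2`; such a `J` is
principal, `J = (Q)` (gen 18), and `W = Z(I(W)) = Z(θ⁻¹((Q))) = S(g; Q)` (gen 19's certificate).
Torus fibres over infinitely many `t` follow from `dim cl π(W ∩ G²) = 1`.  LITERAL CAPSTONES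
(`unprojectedDense_of_mmCase_of_base_eq_paramCurve`, `_of_gt`): every `W` of the case whose base
curve is `g(ℂ)` with `2 ≤ deg g₀ < deg g₁` and `deg g₀ ∤ deg g₁` (or the phase condition of file
XXI) has Zariski-dense exponential points; e.g. **every `W` of the case over the cuspidal cubic
`x₀³ = x₁²`** (`unprojectedDense_of_mmCase_of_base_eq_cusp`).  What stays OPEN: vanishing phase
with `Q ∈ ℂ[t, y₀]`; `deg g₀ = deg g₁`; base curves that are not polynomially parametrised
(several places at infinity); Fib(3,2); EC(3,2).  Mantova–Masser's question is OPEN in general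
(PLMS 2024 §1 p. 5); NOT Schanuel's conjecture (neither used nor implied; EAC ⇏ SC).
-/

noncomputable section

open Complex MvPolynomial
open Literature.NumberTheory.Transcendental Literature.ModelTheory.Zilber
open Literature.ModelTheory.ExponentialFields

set_option linter.dupNamespace false

namespace Summit.Schanuel.Schanuel.Theorems

section Dictionary

variable (g₀ g₁ : Polynomial ℂ)

/-! ## Part A. `θ : ℂ[x, y] → ℂ[t, y]` is integral -/

/-- **Integrality of the substitution `θ : x₀ ↦ g₀(t), x₁ ↦ g₁(t), yᵢ ↦ yᵢ`** (`deg g₀ ≥ 1`):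
`ℂ[t, y₀, y₁]` is integral over `ℂ[x₀, x₁, y₀, y₁]` through `θ` (from gen 19's quotient version
with `Q = 0`, the quotient map by `(0)` being injective). (new) -/
theorem isIntegral_paramSubst₃ (hg₀ : 1 ≤ g₀.natDegree) :
    ((aeval (Sum.elim ![Polynomial.aeval (X 0 : MvPolynomial (Fin 3) ℂ) g₀,
          Polynomial.aeval (X 0 : MvPolynomial (Fin 3) ℂ) g₁]
        (fun i => X (Fin.succ i)) : Fin 2 ⊕ Fin 2 → MvPolynomial (Fin 3) ℂ) :
        MvPolynomial (Fin 2 ⊕ Fin 2) ℂ →ₐ[ℂ] MvPolynomial (Fin 3) ℂ).toRingHom).IsIntegral := by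
  set θ : MvPolynomial (Fin 2 ⊕ Fin 2) ℂ →ₐ[ℂ] MvPolynomial (Fin 3) ℂ :=
    aeval (Sum.elim ![Polynomial.aeval (X 0 : MvPolynomial (Fin 3) ℂ) g₀,
          Polynomial.aeval (X 0 : MvPolynomial (Fin 3) ℂ) g₁]
        (fun i => X (Fin.succ i)) : Fin 2 ⊕ Fin 2 → MvPolynomial (Fin 3) ℂ) with hθ
  have h := isIntegral_paramSubst_quot₃ g₀ g₁ hg₀ 0
  set mk := Ideal.Quotient.mk (Ideal.span {(0 : MvPolynomial (Fin 3) ℂ)}) with hmk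
  have hinj : Function.Injective mk := by
    intro a b hab
    rw [hmk, Ideal.Quotient.eq, Ideal.mem_span_singleton] at hab
    exact sub_eq_zero.1 (zero_dvd_iff.1 hab)
  have hcomp : ((Ideal.Quotient.mkₐ ℂ (Ideal.span {(0 : MvPolynomial (Fin 3) ℂ)})).comp θ).toRingHom =
      mk.comp θ.toRingHom := rfl
  intro b
  obtain ⟨p, hp, hpb⟩ := h (mk b)
  refine ⟨p, hp, hinj ?_⟩
  rw [map_zero, Polynomial.hom_eval₂, ← hcomp]
  exact hpb

/-! ## Part B. Irreducible surfaces over `C = g(ℂ)` are `S(g; Q)` -/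

/-- **An irreducible closed surface all of whose points lie over `C = {(g₀(t), g₁(t))}` is an
`S(g; Q)` with `Q` irreducible** (`deg g₀ ≥ 1`).  Lying-over for the integral `θ`, dimension by
integrality, height-one primes principal, gen 19's certificate `S(g; Q) = Z(θ⁻¹((Q)))`. (new) -/
theorem exists_eq_paramSurface₃_of_forall_exists (hg₀ : 1 ≤ g₀.natDegree)
    {W : Set (Fin 2 ⊕ Fin 2 → ℂ)} (hW : IsIrreducibleClosed ℂ W) (hdim : zariskiDim ℂ W = (2 : ℕ))
    (hπ : ∀ w ∈ W, ∃ t : ℂ, w (Sum.inl 0) = g₀.eval t ∧ w (Sum.inl 1) = g₁.eval t) :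
    ∃ Q : MvPolynomial (Fin 3) ℂ, Irreducible Q ∧
      W = {w : Fin 2 ⊕ Fin 2 → ℂ | ∃ t : ℂ, w (Sum.inl 0) = g₀.eval t ∧ w (Sum.inl 1) = g₁.eval t ∧
        MvPolynomial.eval (Fin.cases t (fun i => w (Sum.inr i)) : Fin 3 → ℂ) Q = 0} := by
  set θ : MvPolynomial (Fin 2 ⊕ Fin 2) ℂ →ₐ[ℂ] MvPolynomial (Fin 3) ℂ :=
    aeval (Sum.elim ![Polynomial.aeval (X 0 : MvPolynomial (Fin 3) ℂ) g₀,
          Polynomial.aeval (X 0 : MvPolynomial (Fin 3) ℂ) g₁]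
        (fun i => X (Fin.succ i)) : Fin 2 ⊕ Fin 2 → MvPolynomial (Fin 3) ℂ) with hθ_def
  set I : Ideal (MvPolynomial (Fin 2 ⊕ Fin 2) ℂ) := vanishingIdeal ℂ W with hI
  haveI hIprime : I.IsPrime := hW.2
  -- the kernel of `θ` vanishes on `W`
  have hker : RingHom.ker θ.toRingHom ≤ I := by
    intro f hf
    rw [RingHom.mem_ker] at hf
    rw [hI, mem_vanishingIdeal_iff]
    intro w hw
    obtain ⟨t, h0, h1⟩ := hπ w hw
    rw [← eval_aeval_paramSubst g₀ g₁ h0 h1 f]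
    change MvPolynomial.eval _ (θ.toRingHom f) = 0
    rw [hf, map_zero]
  -- lying over
  letI : Algebra (MvPolynomial (Fin 2 ⊕ Fin 2) ℂ) (MvPolynomial (Fin 3) ℂ) := θ.toRingHom.toAlgebra
  haveI : Algebra.IsIntegral (MvPolynomial (Fin 2 ⊕ Fin 2) ℂ) (MvPolynomial (Fin 3) ℂ) :=
    ⟨isIntegral_paramSubst₃ g₀ g₁ hg₀⟩
  obtain ⟨J, -, hJprime, hJcomap⟩ := Ideal.exists_ideal_over_prime_of_isIntegral I
    (⊥ : Ideal (MvPolynomial (Fin 3) ℂ)) (by rw [← RingHom.ker_eq_comap_bot]; exact hker)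
  have hJcomap' : Ideal.comap θ J = I := by
    rw [← hJcomap]
    rfl
  -- `ℂ[x, y]/I ↪ ℂ[t, y]/J` is injective and integral, so `dim ℂ[t, y]/J = 2`
  set f : MvPolynomial (Fin 2 ⊕ Fin 2) ℂ →+* MvPolynomial (Fin 3) ℂ ⧸ J :=
    (Ideal.Quotient.mk J).comp θ.toRingHom with hf
  have hfint : f.IsIntegral :=
    (isIntegral_paramSubst₃ g₀ g₁ hg₀).trans _ _
      (RingHom.isIntegral_of_surjective _ Ideal.Quotient.mk_surjective)
  have hkerf : RingHom.ker f = I := by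
    ext r
    rw [RingHom.mem_ker, hf, RingHom.comp_apply, Ideal.Quotient.eq_zero_iff_mem, ← hJcomap',
      Ideal.mem_comap]
    rfl
  haveI := hJprime
  have hdimJ : ringKrullDim (MvPolynomial (Fin 3) ℂ ⧸ J) = (2 : ℕ) := by
    letI : Algebra (MvPolynomial (Fin 2 ⊕ Fin 2) ℂ ⧸ RingHom.ker f) (MvPolynomial (Fin 3) ℂ ⧸ J) :=
      (RingHom.kerLift f).toAlgebra
    haveI : Algebra.IsIntegral (MvPolynomial (Fin 2 ⊕ Fin 2) ℂ ⧸ RingHom.ker f)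
        (MvPolynomial (Fin 3) ℂ ⧸ J) := by
      refine ⟨fun b => ?_⟩
      obtain ⟨p, hp, hpb⟩ := hfint b
      refine ⟨p.map (Ideal.Quotient.mk (RingHom.ker f)), hp.map _, ?_⟩
      rw [Polynomial.eval₂_map]
      have hcomp : (algebraMap (MvPolynomial (Fin 2 ⊕ Fin 2) ℂ ⧸ RingHom.ker f)
          (MvPolynomial (Fin 3) ℂ ⧸ J)).comp (Ideal.Quotient.mk (RingHom.ker f)) = f := by
        ext r <;> simp [RingHom.algebraMap_toAlgebra, hf]
      rw [hcomp]; exact hpb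
    rw [← Literature.RingTheory.KrullDimension.ringKrullDim_eq_of_isIntegral
      (R := MvPolynomial (Fin 2 ⊕ Fin 2) ℂ ⧸ RingHom.ker f) (S := MvPolynomial (Fin 3) ℂ ⧸ J)
      (RingHom.kerLift_injective f), ringKrullDim_eq_of_ringEquiv (Ideal.quotEquivOfEq hkerf)]
    unfold zariskiDim at hdim
    rw [← hI] at hdim
    exact hdim
  obtain ⟨Q, hQ, hJQ⟩ := exists_eq_span_singleton_of_ringKrullDim_eq_two hJprime hdimJ
  refine ⟨Q, hQ.irreducible, ?_⟩
  rw [paramSurface₃_eq_zeroLocus g₀ g₁ hg₀ Q, ← hθ_def, ← hJQ, hJcomap', hI]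
  exact eq_zeroLocus_vanishingIdeal_of_isZariskiClosed hW.1

/-- **If the Zariski closure of `π(W ∩ G²)` is the curve `C = g(ℂ)`, every point of `W` lies over
`C`** (`W ∩ G²` is Zariski dense in the irreducible `W`, and `C` — being a zero locus by
hypothesis — is closed). (new) -/
theorem forall_exists_param_of_base_eq_paramCurve {W : Set (Fin 2 ⊕ Fin 2 → ℂ)}
    (hW : IsIrreducibleClosed ℂ W) (hne : (W ∩ torusLocus ℂ 2).Nonempty)
    (hbase : zeroLocus ℂ (vanishingIdeal ℂ (projAdd '' (W ∩ torusLocus ℂ 2))) =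
      {x : Fin 2 → ℂ | ∃ t : ℂ, x 0 = g₀.eval t ∧ x 1 = g₁.eval t}) :
    ∀ w ∈ W, ∃ t : ℂ, w (Sum.inl 0) = g₀.eval t ∧ w (Sum.inl 1) = g₁.eval t := by
  intro w hw
  have hmem : (w ∘ Sum.inl) ∈ zeroLocus ℂ (vanishingIdeal ℂ (projAdd '' (W ∩ torusLocus ℂ 2))) := by
    rw [mem_zeroLocus_iff]
    intro q hq
    rw [vanishingIdeal_image_projAdd, vanishingIdeal_inter_torusLocus hW hne, Ideal.mem_comap,
      mem_vanishingIdeal_iff] at hq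
    have h := hq w hw
    rwa [aeval_rename] at h
  rw [hbase] at hmem
  obtain ⟨t, h0, h1⟩ := hmem
  exact ⟨t, h0, h1⟩

variable {g₀ g₁}

/-- **Torus fibres over infinitely many parameters** for an irreducible `S(g; Q)` with non-empty
torus part and `dim cl π(S ∩ G²) = 1` (else `π(S ∩ G²)` is a single point). (new) -/
theorem infinite_torusFibres_paramSurface₃_of_addProjDim_eq_one {Q : MvPolynomial (Fin 3) ℂ}
    (hW : IsIrreducibleClosed ℂ {w : Fin 2 ⊕ Fin 2 → ℂ | ∃ t : ℂ, w (Sum.inl 0) = g₀.eval t ∧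
      w (Sum.inl 1) = g₁.eval t ∧
      MvPolynomial.eval (Fin.cases t (fun i => w (Sum.inr i)) : Fin 3 → ℂ) Q = 0})
    (hne : ({w : Fin 2 ⊕ Fin 2 → ℂ | ∃ t : ℂ, w (Sum.inl 0) = g₀.eval t ∧
      w (Sum.inl 1) = g₁.eval t ∧
      MvPolynomial.eval (Fin.cases t (fun i => w (Sum.inr i)) : Fin 3 → ℂ) Q = 0} ∩
      torusLocus ℂ 2).Nonempty)
    (h1 : addProjDim ℂ 2 {w : Fin 2 ⊕ Fin 2 → ℂ | ∃ t : ℂ, w (Sum.inl 0) = g₀.eval t ∧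
      w (Sum.inl 1) = g₁.eval t ∧
      MvPolynomial.eval (Fin.cases t (fun i => w (Sum.inr i)) : Fin 3 → ℂ) Q = 0} = (1 : ℕ)) :
    Set.Infinite {t : ℂ | ∃ c : Fin 2 → ℂ, c 0 ≠ 0 ∧ c 1 ≠ 0 ∧
      MvPolynomial.eval ![t, c 0, c 1] Q = 0} := by
  classical
  intro hfin
  set W := {w : Fin 2 ⊕ Fin 2 → ℂ | ∃ t : ℂ, w (Sum.inl 0) = g₀.eval t ∧
      w (Sum.inl 1) = g₁.eval t ∧
      MvPolynomial.eval (Fin.cases t (fun i => w (Sum.inr i)) : Fin 3 → ℂ) Q = 0} with hWdef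
  set V := projAdd '' (W ∩ torusLocus ℂ 2) with hV
  set T := hfin.toFinset with hT
  -- every torus point of `W` lies over `g(t)` for some `t ∈ T`
  have hmemT : ∀ x ∈ V, ∃ t ∈ T, x 0 = g₀.eval t ∧ x 1 = g₁.eval t := by
    rintro _ ⟨w, ⟨⟨t, h0, h1', hQ⟩, hwt⟩, rfl⟩
    refine ⟨t, ?_, by simpa [projAdd] using h0, by simpa [projAdd] using h1'⟩
    rw [hT, Set.Finite.mem_toFinset]
    refine ⟨![w (Sum.inr 0), w (Sum.inr 1)], ?_, ?_, ?_⟩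
    · simpa using (mem_torusLocus_iff.1 hwt) 0
    · simpa using (mem_torusLocus_iff.1 hwt) 1
    · have e : (Fin.cases t (fun i => w (Sum.inr i)) : Fin 3 → ℂ) =
          ![t, w (Sum.inr 0), w (Sum.inr 1)] := by
        funext i
        refine Fin.cases ?_ (fun j => ?_) i
        · rfl
        · simp only [Fin.cases_succ]
          fin_cases j <;> simp
      simpa [e] using hQ
  -- `∏_{t ∈ T} (Xᵢ - gᵢ(t))` vanishes on `V`; `I(V)` is prime, so one factor does (i = 0, 1)
  set 𝔮 : Ideal (MvPolynomial (Fin 2) ℂ) := vanishingIdeal ℂ V with h𝔮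
  haveI h𝔮prime : 𝔮.IsPrime := isPrime_vanishingIdeal_projAdd hW hne
  have hcoord : ∀ (i : Fin 2) (g : Polynomial ℂ), (∀ x ∈ V, ∃ t ∈ T, x i = g.eval t) →
      ∃ t₀ : ℂ, ∀ x ∈ V, x i = g.eval t₀ := by
    intro i g hx
    have hprod : (∏ t ∈ T, (MvPolynomial.X i - MvPolynomial.C (g.eval t) :
        MvPolynomial (Fin 2) ℂ)) ∈ 𝔮 := by
      rw [h𝔮, mem_vanishingIdeal_iff]
      intro x hxV
      obtain ⟨t, htT, hxt⟩ := hx x hxV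
      rw [map_prod]
      exact Finset.prod_eq_zero htT (by simp [hxt])
    obtain ⟨t₀, -, ht₀⟩ := (Ideal.IsPrime.prod_mem_iff.1 hprod)
    refine ⟨t₀, fun x hxV => ?_⟩
    rw [h𝔮, mem_vanishingIdeal_iff] at ht₀
    have := ht₀ x hxV
    rw [map_sub, MvPolynomial.aeval_X, MvPolynomial.aeval_C, sub_eq_zero] at this
    exact this
  obtain ⟨t₀, ht₀⟩ := hcoord 0 g₀ (fun x hx => by
    obtain ⟨t, ht, h0, -⟩ := hmemT x hx; exact ⟨t, ht, h0⟩)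
  obtain ⟨t₁, ht₁⟩ := hcoord 1 g₁ (fun x hx => by
    obtain ⟨t, ht, -, h1'⟩ := hmemT x hx; exact ⟨t, ht, h1'⟩)
  -- hence `V ⊆ {(g₀(t₀), g₁(t₁))}`, a point, of dimension `0 < 1`
  have hsub : V ⊆ {(![g₀.eval t₀, g₁.eval t₁] : Fin 2 → ℂ)} := by
    intro x hx
    rw [Set.mem_singleton_iff]
    funext i
    fin_cases i
    · simpa using ht₀ x hx
    · simpa using ht₁ x hx
  have hle := zariskiDim_mono (K := ℂ) hsub
  unfold addProjDim at h1
  rw [← hV] at h1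
  rw [h1, zariskiDim_singleton_fin] at hle
  exact absurd hle (by norm_num)

variable (g₀ g₁)

/-! ## Part C. From Mantova–Masser's case to `S(g; Q)`, and the literal capstones -/

/-- **The dictionary lemma over a polynomially parametrised curve.**  A `W` in Mantova–Masser's
case (dim-π-S-1-free) whose base curve (the Zariski closure of `π(W ∩ G²)`) is
`C = {(g₀(t), g₁(t))}` (`deg g₀ ≥ 1`) is `S(g; Q)` for some irreducible `Q ∈ ℂ[t, y₀, y₁]` such
that `Q(t; ·)` vanishes somewhere on `(ℂˣ)²` for infinitely many `t`. (new) -/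
theorem exists_eq_paramSurface₃_of_mmCase (hg₀ : 1 ≤ g₀.natDegree) {W : Set (Fin 2 ⊕ Fin 2 → ℂ)}
    (hmm : MMCaseDimPiOneFree W)
    (hbase : zeroLocus ℂ (vanishingIdeal ℂ (projAdd '' (W ∩ torusLocus ℂ 2))) =
      {x : Fin 2 → ℂ | ∃ t : ℂ, x 0 = g₀.eval t ∧ x 1 = g₁.eval t}) :
    ∃ Q : MvPolynomial (Fin 3) ℂ, Irreducible Q ∧
      Set.Infinite {t : ℂ | ∃ c : Fin 2 → ℂ, c 0 ≠ 0 ∧ c 1 ≠ 0 ∧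
        MvPolynomial.eval ![t, c 0, c 1] Q = 0} ∧
      W = {w : Fin 2 ⊕ Fin 2 → ℂ | ∃ t : ℂ, w (Sum.inl 0) = g₀.eval t ∧ w (Sum.inl 1) = g₁.eval t ∧
        MvPolynomial.eval (Fin.cases t (fun i => w (Sum.inr i)) : Fin 3 → ℂ) Q = 0} := by
  obtain ⟨hW, hne, hdim, h1, -⟩ := hmm
  have hπ := forall_exists_param_of_base_eq_paramCurve g₀ g₁ hW hne hbase
  obtain ⟨Q, hQ, hWQ⟩ := exists_eq_paramSurface₃_of_forall_exists g₀ g₁ hg₀ hW hdim hπ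
  refine ⟨Q, hQ, ?_, hWQ⟩
  subst hWQ
  exact infinite_torusFibres_paramSurface₃_of_addProjDim_eq_one hW hne h1

/-- **LITERAL CAPSTONE.**  Every `W ⊆ ℂ² × ℂ²` in Mantova–Masser's case (dim-π-S-1-free) whose base
curve is the polynomially parametrised curve `{(g₀(t), g₁(t))}` with `2 ≤ deg g₀ < deg g₁` and
`deg g₀ ∤ deg g₁ ∨ Re(lc(g₁)(i/lc(g₀))^{deg g₁ / deg g₀}) ≠ 0` has Zariski-dense exponential points
(`I(W ∩ Γ_exp) = I(W)`).
[cite: MantovaMasser2023, §1 Further remarks, p. 5 (the question, open in general)] (new) -/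
theorem unprojectedDense_of_mmCase_of_base_eq_paramCurve (hd : 2 ≤ g₀.natDegree)
    (hlt : g₀.natDegree < g₁.natDegree)
    (hph : ¬ g₀.natDegree ∣ g₁.natDegree ∨
      (g₁.leadingCoeff * (I / g₀.leadingCoeff) ^ (g₁.natDegree / g₀.natDegree)).re ≠ 0)
    {W : Set (Fin 2 ⊕ Fin 2 → ℂ)} (hmm : MMCaseDimPiOneFree W)
    (hbase : zeroLocus ℂ (vanishingIdeal ℂ (projAdd '' (W ∩ torusLocus ℂ 2))) =
      {x : Fin 2 → ℂ | ∃ t : ℂ, x 0 = g₀.eval t ∧ x 1 = g₁.eval t}) :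
    UnprojectedDense W := by
  obtain ⟨Q, hQ, hfib, rfl⟩ := exists_eq_paramSurface₃_of_mmCase g₀ g₁ (by omega) hmm hbase
  exact (unprojectedDensityQuestion_paramSurface₃_complete g₀ g₁ hd hlt hph hQ hfib).2

/-- **LITERAL CAPSTONE, mirror** (`2 ≤ deg g₁ < deg g₀`, phase condition with the roles swapped).
[cite: MantovaMasser2023, §1 Further remarks, p. 5 (the question, open in general)] (new) -/
theorem unprojectedDense_of_mmCase_of_base_eq_paramCurve_of_gt (hd : 2 ≤ g₁.natDegree)
    (hlt : g₁.natDegree < g₀.natDegree)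
    (hph : ¬ g₁.natDegree ∣ g₀.natDegree ∨
      (g₀.leadingCoeff * (I / g₁.leadingCoeff) ^ (g₀.natDegree / g₁.natDegree)).re ≠ 0)
    {W : Set (Fin 2 ⊕ Fin 2 → ℂ)} (hmm : MMCaseDimPiOneFree W)
    (hbase : zeroLocus ℂ (vanishingIdeal ℂ (projAdd '' (W ∩ torusLocus ℂ 2))) =
      {x : Fin 2 → ℂ | ∃ t : ℂ, x 0 = g₀.eval t ∧ x 1 = g₁.eval t}) :
    UnprojectedDense W := by
  obtain ⟨Q, hQ, hfib, rfl⟩ := exists_eq_paramSurface₃_of_mmCase g₀ g₁ (by omega) hmm hbase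
  exact (unprojectedDensityQuestion_paramSurface₃_complete_of_gt g₀ g₁ hd hlt hph hQ hfib).2

/-- **Mantova–Masser's question, literally, over a polynomial curve with `2 ≤ deg g₀ < deg g₁`,
`deg g₀ ∤ deg g₁`:** `MMCaseDimPiOneFree W → UnprojectedDense W` for every `W` with that base
curve. [cite: MantovaMasser2023, §1 Further remarks, p. 5 (the question, open in general)] (new) -/
theorem unprojectedDensityQuestion_of_base_eq_paramCurve (hd : 2 ≤ g₀.natDegree)
    (hlt : g₀.natDegree < g₁.natDegree) (hndvd : ¬ g₀.natDegree ∣ g₁.natDegree)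
    {W : Set (Fin 2 ⊕ Fin 2 → ℂ)}
    (hbase : zeroLocus ℂ (vanishingIdeal ℂ (projAdd '' (W ∩ torusLocus ℂ 2))) =
      {x : Fin 2 → ℂ | ∃ t : ℂ, x 0 = g₀.eval t ∧ x 1 = g₁.eval t}) :
    MMCaseDimPiOneFree W → UnprojectedDense W := fun hmm =>
  unprojectedDense_of_mmCase_of_base_eq_paramCurve g₀ g₁ hd hlt (Or.inl hndvd) hmm hbase

end Dictionary

/-! ## Part D. Every surface of the case over the cusp `x₀³ = x₁²` -/

/-- **Every `W` of Mantova–Masser's case whose base curve is the cuspidal cubic `x₀³ = x₁²` has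
Zariski-dense exponential points.** [cite: MantovaMasser2023, §1 Further remarks, p. 5 (the
question, open in general)] (new) -/
theorem unprojectedDense_of_mmCase_of_base_eq_cusp {W : Set (Fin 2 ⊕ Fin 2 → ℂ)}
    (hmm : MMCaseDimPiOneFree W)
    (hbase : zeroLocus ℂ (vanishingIdeal ℂ (projAdd '' (W ∩ torusLocus ℂ 2))) =
      {x : Fin 2 → ℂ | x 0 ^ 3 = x 1 ^ 2}) :
    UnprojectedDense W := by
  rw [cusp_eq_paramCurve] at hbase
  refine unprojectedDense_of_mmCase_of_base_eq_paramCurve (Polynomial.X ^ 2) (Polynomial.X ^ 3)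
    (by simp) (by simp) (Or.inl ?_) hmm hbase
  simp only [Polynomial.natDegree_pow, Polynomial.natDegree_X]
  norm_num

/-- **Every `W` of Mantova–Masser's case whose base curve is the nodal cubic `x₁² = x₀²(x₀ + 1)`
has Zariski-dense exponential points.** [cite: MantovaMasser2023, §1 Further remarks, p. 5 (the
question, open in general)] (new) -/
theorem unprojectedDense_of_mmCase_of_base_eq_node {W : Set (Fin 2 ⊕ Fin 2 → ℂ)}
    (hmm : MMCaseDimPiOneFree W)
    (hbase : zeroLocus ℂ (vanishingIdeal ℂ (projAdd '' (W ∩ torusLocus ℂ 2))) =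
      {x : Fin 2 → ℂ | x 1 ^ 2 = x 0 ^ 2 * (x 0 + 1)}) :
    UnprojectedDense W := by
  rw [node_eq_paramCurve] at hbase
  have hd2 : (Polynomial.X ^ 2 - 1 : Polynomial ℂ).natDegree = 2 := by
    rw [Polynomial.natDegree_sub_eq_left_of_natDegree_lt] <;> simp
  have hd3 : (Polynomial.X ^ 3 - Polynomial.X : Polynomial ℂ).natDegree = 3 := by
    rw [Polynomial.natDegree_sub_eq_left_of_natDegree_lt] <;> simp
  refine unprojectedDense_of_mmCase_of_base_eq_paramCurve (Polynomial.X ^ 2 - 1)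
    (Polynomial.X ^ 3 - Polynomial.X) (by rw [hd2]) (by rw [hd2, hd3]; norm_num) (Or.inl ?_) hmm hbase
  rw [hd2, hd3]
  norm_num

end Summit.Schanuel.Schanuel.Theorems
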